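import Mathlib
import Literature.NumberTheory.Transcendental.RoyCriterion
import Summits.Schanuel.Schanuel.Theses.PolarPhantoms

/-!
# Sketch — crux-ideate stmt-Schanuel-6845 (TraceZeroEstimate), ideator 3, round 1

First-lemma signatures for the three idea cards (nothing is proved here; every `def` is a `Prop`).
`royDF` is Roy's derivation `D = ∂₀ + X₁∂₁` on `F[X₀,X₁]`, written exactly as in the crux signature.
-/

namespace Summit.Schanuel.Schanuel.Cruxes.TraceZeroEstimate.Sketch

open MvPolynomial Filter Literature.NumberTheory.Transcendental

noncomputable section

/-- Roy's derivation on `F[X₀,X₁]` (the `fun Q => …` of the crux signature). -/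
def royDF {R : Type*} [CommRing R] (Q : MvPolynomial (Fin 2) R) : MvPolynomial (Fin 2) R :=
  pderiv 0 Q + X 1 * pderiv 1 Q

/-- The rank-one trace zero estimate with the SAME shape as the crux, `n = 1`. -/
def TZE₁ : Prop :=
  ∀ (F : IntermediateField ℚ ℂ) [FiniteDimensional ℚ F] (y α : F), y ≠ 0 → α ≠ 0 →
    ∀ s₀ s₁ t₀ t₁ u : ℝ, RoyAdmissible s₀ s₁ t₀ t₁ u →
      ∀ᶠ N : ℕ in atTop, ∀ B : MvPolynomial (Fin 2) F,
        (B.degreeOf 0 : ℝ) ≤ (N : ℝ) ^ t₀ → (B.degreeOf 1 : ℝ) ≤ (N : ℝ) ^ t₁ →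
        (∀ k m : ℕ, (k : ℝ) ≤ (N : ℝ) ^ s₀ → (m : ℝ) ≤ (N : ℝ) ^ s₁ →
          Algebra.trace ℚ F (aeval ![(m : F) * y, α ^ m] (royDF^[k] B)) = 0) →
        ∀ e : Fin 2 →₀ ℕ, Algebra.trace ℚ F (B.coeff e) = 0

/-! ## Card `orbit-wronskian` -/

/-- FIRST LEMMA (card orbit-wronskian): the trace zero estimate at a RATIONAL additive coordinate
`y₀ ∈ ℚˣ` and an arbitrary algebraic `α ∈ Fˣ` (all conjugate orbits share the points `z = m y₀`;
this is the input of "`e ∉ ℚ̄` by polarity").  Claimed provable by the Wronskian count (M3–M4 of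
NOTES.md); NOT an instance of `Philippon1986_GaGm` (the trivial subgroup satisfies Philippon's
inequality on `𝔾ₐ × 𝔾ₘ^g` in Roy's window as soon as `t₀ + g t₁ ≥ s₀ + s₁`). -/
def RationalAdditiveTZE : Prop :=
  ∀ (F : IntermediateField ℚ ℂ) [FiniteDimensional ℚ F] (y₀ : ℚ) (α : F), y₀ ≠ 0 → α ≠ 0 →
    ∀ s₀ s₁ t₀ t₁ u : ℝ, RoyAdmissible s₀ s₁ t₀ t₁ u →
      ∀ᶠ N : ℕ in atTop, ∀ B : MvPolynomial (Fin 2) F,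
        (B.degreeOf 0 : ℝ) ≤ (N : ℝ) ^ t₀ → (B.degreeOf 1 : ℝ) ≤ (N : ℝ) ^ t₁ →
        (∀ k m : ℕ, (k : ℝ) ≤ (N : ℝ) ^ s₀ → (m : ℝ) ≤ (N : ℝ) ^ s₁ →
          Algebra.trace ℚ F (aeval ![(m : F) * (y₀ : F), α ^ m] (royDF^[k] B)) = 0) →
        ∀ e : Fin 2 →₀ ℕ, Algebra.trace ℚ F (B.coeff e) = 0

/-- Support lemma W1 (shape of the Wronskian of an exponential–polynomial frame): the Wronskian
of `z ↦ e^{b_j z} q_j(z)` is `e^{(Σ b_j) z} · P(z)` with `deg P ≤ Σ deg q_j`. [folklore] -/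
def ExpPolyWronskianShape : Prop :=
  ∀ (G : ℕ) (b : Fin G → ℕ) (q : Fin G → Polynomial ℂ),
    ∃ P : Polynomial ℂ, P.natDegree ≤ ∑ j, (q j).natDegree ∧
      ∀ z : ℂ, (Matrix.of fun i j : Fin G =>
          iteratedDeriv (i : ℕ) (fun w : ℂ => Complex.exp ((b j : ℂ) * w) * (q j).eval w) z).det
        = Complex.exp ((∑ j, (b j : ℂ)) * z) * P.eval z

/-- Support lemma W2 (osculation): if a nonzero combination of `G ≤ K + 1` entire functions
vanishes to order `K + 1` at `z₀`, their Wronskian vanishes there to order `≥ K + 2 - G`.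
[folklore] -/
def OsculationOrder : Prop :=
  ∀ (G K : ℕ) (f : Fin G → ℂ → ℂ) (c : Fin G → ℂ) (z₀ : ℂ),
    (∀ j, Differentiable ℂ (f j)) → c ≠ 0 → G ≤ K + 1 →
    (∀ k ≤ K, iteratedDeriv k (fun z => ∑ j, c j * f j z) z₀ = 0) →
    ∀ r : ℕ, r + G < K + 2 →
      iteratedDeriv r (fun z => (Matrix.of fun i j : Fin G => iteratedDeriv (i : ℕ) (f j) z).det) z₀ = 0

/-! ## Card `trace-annihilator-staircase` -/

/-- The strong form behind the card (rank one): every trace-jet functional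
`B ↦ Tr((D^{k'} B)(n' y, α^{n'}))`, for ANY `(k', n') ∈ ℕ²`, is a `ℚ`-combination of those with
`(k, n)` in Roy's box — i.e. `ℚ[t,δ]_{≤(M,K)} ↠ ℚ[t,δ]/Ann(λ₀)` (bigraded regularity of the
truncated-exponential jet scheme `Z`). -/
def BoxSpansAllOrbitJets : Prop :=
  ∀ (F : IntermediateField ℚ ℂ) [FiniteDimensional ℚ F] (y α : F), y ≠ 0 → α ≠ 0 →
    ∀ s₀ s₁ t₀ t₁ u : ℝ, RoyAdmissible s₀ s₁ t₀ t₁ u →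
      ∀ᶠ N : ℕ in atTop, ∀ k' n' : ℕ, ∃ c : ℕ → ℕ → ℚ, ∀ B : MvPolynomial (Fin 2) F,
        (B.degreeOf 0 : ℝ) ≤ (N : ℝ) ^ t₀ → (B.degreeOf 1 : ℝ) ≤ (N : ℝ) ^ t₁ →
        Algebra.trace ℚ F (aeval ![(n' : F) * y, α ^ n'] (royDF^[k'] B)) =
          ∑ k ∈ Finset.range (⌊(N : ℝ) ^ s₀⌋₊ + 1), ∑ n ∈ Finset.range (⌊(N : ℝ) ^ s₁⌋₊ + 1),
            c k n • Algebra.trace ℚ F (aeval ![(n : F) * y, α ^ n] (royDF^[k] B))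

/-- FIRST LEMMA (card trace-annihilator-staircase): the strong form implies the crux shape at
`n = 1` (pure linear algebra: take `n' = 0`; the Hermite jet matrix `(C(k,a) a! b^{k-a})` of the
functionals `B ↦ (D^k B)(0,1)`, `k < (D₀+1)(D₁+1)`, is invertible). -/
def BoxSpan_implies_TZE₁ : Prop := BoxSpansAllOrbitJets → TZE₁

/-! ## Card `norm-point-propagation` -/

/-- The propagation statement (rank one): trace-vanishing of the `K`-jets on the orbit `γ^m`
forces `B`'s jets to be blind to replacing the last factor `γ` by a conjugate `σγ`:
`(D^k B)(γ^{m+1}) = (D^k B)(γ^m · σγ)` (equivalently the defect polynomial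
`Δ_σ = B(X₀+y, αX₁) − B(X₀+σy, σα X₁)` has vanishing `K`-jets along the orbit). -/
def PropagationToConjugates : Prop :=
  ∀ (F : IntermediateField ℚ ℂ) [FiniteDimensional ℚ F] (y α : F), y ≠ 0 → α ≠ 0 →
    ∀ s₀ s₁ t₀ t₁ u : ℝ, RoyAdmissible s₀ s₁ t₀ t₁ u →
      ∀ᶠ N : ℕ in atTop, ∀ B : MvPolynomial (Fin 2) F,
        (B.degreeOf 0 : ℝ) ≤ (N : ℝ) ^ t₀ → (B.degreeOf 1 : ℝ) ≤ (N : ℝ) ^ t₁ →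
        (∀ k m : ℕ, (k : ℝ) ≤ (N : ℝ) ^ s₀ → (m : ℝ) ≤ (N : ℝ) ^ s₁ →
          Algebra.trace ℚ F (aeval ![(m : F) * y, α ^ m] (royDF^[k] B)) = 0) →
        ∀ (σ : F →ₐ[ℚ] ℂ) (k m : ℕ), (k : ℝ) ≤ (N : ℝ) ^ s₀ → (m : ℝ) + 1 ≤ (N : ℝ) ^ s₁ →
          aeval ![((m : ℂ) + 1) * (y : ℂ), (α : ℂ) ^ (m + 1)]
              (royDF^[k] (MvPolynomial.map (algebraMap F ℂ) B)) =
            aeval ![(m : ℂ) * (y : ℂ) + σ y, (α : ℂ) ^ m * σ α]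
              (royDF^[k] (MvPolynomial.map (algebraMap F ℂ) B))

/-- FIRST LEMMA (card norm-point-propagation): propagation implies the crux shape at `n = 1`
(endgame: iterate to the norm point `ρ = (Tr y, Nm α) ∈ G(ℚ)`, where trace commutes with
evaluation, and finish with the in-tree `Philippon1986_GaGm_holds` at a rational point). -/
def Propagation_implies_TZE₁ : Prop := PropagationToConjugates → TZE₁

/-- Sanity link with the route decl: the crux restricted to `n = 1` is implied by the crux. -/
def Crux_implies_TZE₁ : Prop :=
  Summit.Schanuel.Schanuel.Theses.PolarPhantoms.TraceZeroEstimate → TZE₁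

end

end Summit.Schanuel.Schanuel.Cruxes.TraceZeroEstimate.Sketch
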